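import Literature.AlgebraicGeometry.ModuliOfAbelianVarieties.SiegelModuliComplexUniformisation
import Literature.AlgebraicGeometry.AbelianSchemes.AbelianSchemeSymplecticLevelTransfer
import Literature.AlgebraicGeometry.HodgeTheory.IsoTransport
import Literature.AlgebraicGeometry.Motives.AbelianVarietyIsoOfScheme
import Literature.AlgebraicGeometry.Motives.AbelianVarietyIsogenyProofs
import HarnessLib

/-!
# Admissibility of a Siegel triple is invariant under isomorphisms of fibres ([Milne 2005] Thm. 6.11; [MFK94] Def. 7.2)

Topic `Literature/AlgebraicGeometry/ModuliOfAbelianVarieties`; cell hodgecm-mathlib, U-DAG v0.1 §2 GLUE `U_of`, road B,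
step «(U3∃) = D-BC∃ ★ + admissibility transport along the isomorphism `univ ×_𝓜 classify(P) ≅ P`» (B-plan1 R54,
row (α); lowest priority, books 0).  (U)'s predicate ★ `IsAdmissibleAt hδ r Z hZ P′` (`SiegelModuliComplexUniformisation`)
speaks of the GEOMETRIC FIBRE of `P′` at `𝟙 (Spec ℂ)` only: a T1′ marking `m` of the fibre abelian variety by `[J(Z), r]`,
an ample witness `Θ` of the polarisation (`IsLambdaOfAt`) and a symplectic lift `Λ` of the level structure for `Θ`
whose torsion tower read through `r` IS `m`'s torsion parametrisation.  Hence it TRANSPORTS along any isomorphism of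
fibre abelian varieties `e : fibre(P″) ≅ fibre(P′)` carrying the level sections of `P″` to those of `P′` and along
which ample `IsLambdaOfAt` witnesses pull back to ample `IsLambdaOfAt` witnesses — the FIBRE FORM of «isomorphic triples
over `Spec ℂ` ([MumfordFogartyKirwan1994] Def. 7.2 «all up to isomorphism») have the same admissibility», which is the
converse direction of the Road-S W3 transport (there: two markings ⇒ an isomorphism of triples).

* §1 `SiegelAdelicMarking.exists_of_iso` — a marking of `A` by `[J, a]` pushes forward along `e : A ≅ B` to a marking of
  `B` by `[J, a]` with the same lattice basis and `r′ = e ∘ r` (analytification transported by ★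
  `IsAnalytification.transport_iso`, Serre GAGA §2).
* §2 `LevelStructure.SymplecticLift.exists_transport_lift_eq` — ★ (T1) `SymplecticLift.nonempty_transport`
  (`AbelianSchemeSymplecticLevelTransfer`) with its construction EXPOSED: the transported lift is `e⁻¹ ∘ lift`
  (proof adapted verbatim from (T1); the value clause is what the tower condition of `IsAdmissibleAt` needs).
* §3 `isAdmissibleAt_of_fibreIso` — the transport of `IsAdmissibleAt hδ r Z hZ` from `P′` to `P″` along `(e, he, hpol)`
  (hypothesis shapes = those of ★ (T2) `IsSymplecticLiftable.of_fibreIso`).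

Theorems only; no definition, no named fact, no instance, no `sorry`.  The D4-relation form («`P″.IsBaseChangeVia P′`
along `𝟙` with `G` an isomorphism ⇒ `(e, he, hpol)`») is the converse-W3 plumbing and is NOT in this file.  HC_CM is
proved only modulo the 7 printed citations until rung 0 closes; nothing here discharges a binder.

## References
* [Milne2005ShimuraVarieties] J. S. Milne, *Introduction to Shimura Varieties* (2005/2017), §6 Thm. 6.11 pp. 74–75.
* [MumfordFogartyKirwan1994] D. Mumford, J. Fogarty, F. Kirwan, *Geometric Invariant Theory*, 3rd ed., Ch. 7 §2 Def. 7.2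
  (p. 129).
* [Lan2013PELCompactifications] K.-W. Lan, *Arithmetic compactifications of PEL-type Shimura varieties*, §1.3.6
  Lemma 1.3.6.5 (p. 81).
* [MumfordAV1970] D. Mumford, *Abelian Varieties*, §20 property (3) of `e_n` (p. 186).
* [SerreGAGA1956] J.-P. Serre, GAGA, §2.
-/

noncomputable section

open CategoryTheory CategoryTheory.Limits AlgebraicGeometry Matrix Topology

universe u

/-! ## §1 Push-forward of a T1′ marking along an isomorphism of complex abelian varieties -/

namespace Literature.AlgebraicGeometry.ModuliOfAbelianVarieties

open Literature.AlgebraicGeometry.Motives (SchemeOver ComplexPoints AlgPoints specOver AbelianVariety CartierDivisor)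
open Literature.Geometry.Kaehler (ComplexTorus)
open Literature.NumberTheory.Transcendental (IsAnalytification)

namespace SiegelAdelicMarking

variable {g : ℕ} {δ : Fin g → ℕ} {J : C0pm δ} {a : gspFinAdelic δ} {A B : AbelianVariety ℂ}

/-- **A marking of `A` by `[J, a]` pushes forward along an isomorphism `e : A ≅ B` of complex abelian varieties** to a
marking of `B` by the SAME point `[J, a]`, with the same lattice basis `γ` and complex coordinates `Ψ`, uniformisation
`e(ℂ) ∘ toFun` (an analytification of `B` by Serre's functoriality of `X ↦ X^h`, ★ `IsAnalytification.transport_iso`),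
hence torsion parametrisation `r′ = e(ℂ) ∘ r`.  ([Milne2005ShimuraVarieties] Thm. 6.11: the class of `(A, s, ηK)` depends
on the isomorphism class only.) [cite: Milne2005ShimuraVarieties, §6 Thm. 6.11 pp. 74–75] [cite: SerreGAGA1956, §2] -/
theorem exists_of_iso (m : SiegelAdelicMarking J a A) (e : A ≅ B) :
    ∃ m' : SiegelAdelicMarking J a B, m'.γ = m.γ ∧ ∀ v : Fin g ⊕ Fin g → ℚ,
      m'.r v = AlgPoints.map e.hom.hom.hom.hom (m.r v) := by
  -- dimension: an isomorphism is an isogeny, isogenies preserve `dim`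
  have hdim : A.dim = B.dim := by
    haveI : IsIso (AbelianVariety.Hom.toSchemeHom e.hom) :=
      ⟨AbelianVariety.Hom.toSchemeHom e.inv,
        by rw [← AbelianVariety.toSchemeHom_comp, e.hom_inv_id]; rfl,
        by rw [← AbelianVariety.toSchemeHom_comp, e.inv_hom_id]; rfl⟩
    exact AbelianVariety.dim_eq_of_isIsogeny (f := e.hom) ⟨inferInstance, inferInstance⟩
  have han : IsAnalytification (Fin g → ℂ) B.X B.dim (AlgPoints.map e.hom.hom.hom.hom ∘ m.toFun) := by
    rw [← hdim]
    exact m.isAnalytification.transport_iso (AbelianVariety.overIsoOfIso e)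
  let fwd : A.Points ℂ →* B.Points ℂ := IsMonHom.monoidHom e.hom.hom.hom.hom (specOver ℂ ℂ)
  have hfwd : ∀ P, fwd P = AlgPoints.map e.hom.hom.hom.hom P := fun P => rfl
  refine ⟨{ γ := m.γ
            γ_isLatticeBasis := m.γ_isLatticeBasis
            Ψ := m.Ψ
            Ψ_J := m.Ψ_J
            toFun := AlgPoints.map e.hom.hom.hom.hom ∘ m.toFun
            isAnalytification := han
            toFun_add := fun x y => by
              simp only [Function.comp_apply, m.toFun_add, ← hfwd, map_mul] }, rfl, fun v => ?_⟩
  rw [SiegelAdelicMarking.r_def, SiegelAdelicMarking.r_def]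
  rfl

end SiegelAdelicMarking

end Literature.AlgebraicGeometry.ModuliOfAbelianVarieties

/-! ## §2 Transport of a symplectic lift along a fibre isomorphism, with the transported tower exposed -/

namespace Literature.AlgebraicGeometry.AbelianSchemes

namespace AbelianSchemeOver

open Literature.AlgebraicGeometry.Motives
open scoped MonObj

variable {S S' : Scheme.{u}} {A : AbelianSchemeOver S} {A' : AbelianSchemeOver S'} {g N : ℕ}
  {φ : A.LevelStructure g N} {φ' : A'.LevelStructure g N} {Ω : Type u} [Field Ω]
  {s : Spec (.of Ω) ⟶ S} {s' : Spec (.of Ω) ⟶ S'} {δ : Fin g → ℕ}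

/-- **(T1′) TRANSPORT of a symplectic lift along a fibre isomorphism, WITH ITS TOWER**: for an isomorphism
`e : A′_{s′} ≅ A_s` of fibre abelian varieties carrying the sections of `φ′` at `s′` to those of `φ` at `s`, a
symplectic lift `Λ` of `φ` at `s` for `Θ` yields a symplectic lift `Λ′` of `φ′` at `s′` for `e^*Θ` whose tower is
`lift′_M = e⁻¹ ∘ lift_M` ON THE NOSE — the construction of ★ (T1) `SymplecticLift.nonempty_transport`
([MumfordAV1970] §20 (3) functoriality of `e_n`; [Lan] Lemma 1.3.6.5 is a statement about the geometric fibre), with the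
value clause that (U)'s tower condition consumes.  Proof = (T1)'s, verbatim, plus `rfl` for the values.
[cite: MumfordAV1970, §20 (property (3) of e_n, p. 186)] [cite: Lan2013PELCompactifications, §1.3.6 Lemma 1.3.6.5 (p. 81)] -/
theorem LevelStructure.SymplecticLift.exists_transport_lift_eq
    (e : (A'.fibre s').toAbelianVariety ≅ (A.fibre s).toAbelianVariety)
    (he : ∀ i : Fin g ⊕ Fin g,
      AlgPoints.map e.hom.hom.hom.hom (A'.restrictPt s' (φ'.σ i)) = A.restrictPt s (φ.σ i))
    {Θ : CartierDivisor (A.fibre s).toAbelianVariety.X.left} (Λ : φ.SymplecticLift s Θ δ) :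
    haveI := AbelianVariety.isDominant_toSchemeHom_iso_hom e
    ∃ Λ' : φ'.SymplecticLift s' (Θ.pullback (AbelianVariety.Hom.toSchemeHom e.hom)) δ,
      (∀ M, Λ'.ζ M = Λ.ζ M) ∧
      ∀ (M : ℕ) (x : Multiplicative (Fin g ⊕ Fin g → ZMod M)),
        ((Λ'.lift M x : (A'.fibre s').toAbelianVariety.torsionPoints Ω (M : ℤ)) :
            (A'.fibre s').toAbelianVariety.Points Ω) =
          AlgPoints.map e.inv.hom.hom.hom
            ((Λ.lift M x : (A.fibre s).toAbelianVariety.torsionPoints Ω (M : ℤ)) :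
              (A.fibre s).toAbelianVariety.Points Ω) := by
  -- adapted from ★ `AbelianSchemeSymplecticLevelTransfer` (T1) `SymplecticLift.nonempty_transport` (B-p06 g6)
  haveI := AbelianVariety.isDominant_toSchemeHom_iso_hom e
  -- the maps on `Ω`-points induced by `e` and `e⁻¹`
  let fwd : (A'.fibre s').toAbelianVariety.Points Ω →* (A.fibre s).toAbelianVariety.Points Ω :=
    IsMonHom.monoidHom e.hom.hom.hom.hom (specOver Ω Ω)
  let bwd : (A.fibre s).toAbelianVariety.Points Ω →* (A'.fibre s').toAbelianVariety.Points Ω :=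
    IsMonHom.monoidHom e.inv.hom.hom.hom (specOver Ω Ω)
  have hfwd : ∀ P, fwd P = AlgPoints.map e.hom.hom.hom.hom P := fun P => rfl
  have hfb : ∀ P, fwd (bwd P) = P := fun P => by
    change AlgPoints.map e.hom.hom.hom.hom (AlgPoints.map e.inv.hom.hom.hom P) = P
    rw [← AlgPoints.map_comp_apply]
    change AlgPoints.map (e.inv ≫ e.hom).hom.hom.hom P = P
    rw [e.inv_hom_id]
    exact AlgPoints.map_id_apply P
  have hbf : ∀ P, bwd (fwd P) = P := fun P => by
    change AlgPoints.map e.inv.hom.hom.hom (AlgPoints.map e.hom.hom.hom.hom P) = P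
    rw [← AlgPoints.map_comp_apply]
    change AlgPoints.map (e.hom ≫ e.inv).hom.hom.hom P = P
    rw [e.hom_inv_id]
    exact AlgPoints.map_id_apply P
  -- `e⁻¹` on the `M`-torsion
  have hbwd_mem : ∀ (M : ℕ) (P : (A.fibre s).toAbelianVariety.torsionPoints Ω (M : ℤ)),
      bwd P ∈ (A'.fibre s').toAbelianVariety.torsionPoints Ω (M : ℤ) := fun M P => by
    rw [AbelianVariety.mem_torsionPoints_iff, ← map_zpow, (AbelianVariety.mem_torsionPoints_iff _ _).1 P.2,
      map_one]
  let bwdT : ∀ M : ℕ, (A.fibre s).toAbelianVariety.torsionPoints Ω (M : ℤ) →*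
      (A'.fibre s').toAbelianVariety.torsionPoints Ω (M : ℤ) := fun M =>
    (bwd.comp ((A.fibre s).toAbelianVariety.torsionPoints Ω (M : ℤ)).subtype).codRestrict _ (hbwd_mem M)
  have hbwdT : ∀ (M : ℕ) (P : (A.fibre s).toAbelianVariety.torsionPoints Ω (M : ℤ)),
      ((bwdT M P : (A'.fibre s').toAbelianVariety.torsionPoints Ω (M : ℤ)) :
        (A'.fibre s').toAbelianVariety.Points Ω) = bwd P := fun M P => rfl
  refine ⟨{ ζ := Λ.ζ
            isPrimitiveRoot_ζ := Λ.isPrimitiveRoot_ζ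
            ζ_pow := Λ.ζ_pow
            lift := fun M => (bwdT M).comp (Λ.lift M)
            lift_bijective := ?_
            lift_compat := ?_
            lift_level := ?_
            pairing := ?_ }, fun M => rfl, fun M x => rfl⟩
  · -- bijectivity: `e⁻¹` is a bijection on torsion points
    intro M hM hM₀
    have hinj : Function.Injective (bwdT M) := fun P Q hPQ => by
      have h := congrArg (fun R : (A'.fibre s').toAbelianVariety.torsionPoints Ω (M : ℤ) =>
        fwd (R : (A'.fibre s').toAbelianVariety.Points Ω)) hPQ
      simp only [hbwdT, hfb] at h
      exact Subtype.ext h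
    have hsurj : Function.Surjective (bwdT M) := fun Q => by
      have hQ' : fwd Q ∈ (A.fibre s).toAbelianVariety.torsionPoints Ω (M : ℤ) := by
        rw [AbelianVariety.mem_torsionPoints_iff, ← map_zpow, (AbelianVariety.mem_torsionPoints_iff _ _).1 Q.2,
          map_one]
      refine ⟨⟨fwd Q, hQ'⟩, Subtype.ext ?_⟩
      rw [hbwdT]
      exact hbf Q
    rw [MonoidHom.coe_comp]
    exact (show Function.Bijective (bwdT M) from ⟨hinj, hsurj⟩).comp (Λ.lift_bijective hM hM₀)
  · -- tower compatibility
    intro M k x hM hM₀ hk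
    change bwd _ = (bwd _ : (A'.fibre s').toAbelianVariety.Points Ω) ^ k
    rw [← map_pow]
    exact congrArg bwd (Λ.lift_compat k x hM hM₀ hk)
  · -- level `N`: `e⁻¹(σᵢ(s)) = σ′ᵢ(s′)`
    intro i
    change bwd ((Λ.lift N (Multiplicative.ofAdd (Pi.single i 1)) :
        (A.fibre s).toAbelianVariety.torsionPoints Ω (N : ℤ)) : (A.fibre s).toAbelianVariety.Points Ω) = _
    rw [Λ.lift_level i, ← he i, ← hfwd, hbf]
  · -- the pairing clause: `ē^{e^*Θ}(e⁻¹P, e⁻¹Q) = ē^Θ(P, Q) = ζ_M ^ E_δ`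
    intro M hM hMΩ x y
    haveI := AbelianVariety.isDominant_toSchemeHom_zsmul_of_ne_zero (A'.fibre s').toAbelianVariety hMΩ
    haveI := AbelianVariety.isDominant_toSchemeHom_zsmul_of_ne_zero (A.fibre s).toAbelianVariety hMΩ
    have hP : ((Λ.lift M (Multiplicative.ofAdd x) : (A.fibre s).toAbelianVariety.torsionPoints Ω (M : ℤ)) :
          (A.fibre s).toAbelianVariety.Points Ω) =
        AlgPoints.map e.hom.hom.hom.hom
          (((bwdT M).comp (Λ.lift M) (Multiplicative.ofAdd x) :
              (A'.fibre s').toAbelianVariety.torsionPoints Ω (M : ℤ)) :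
            (A'.fibre s').toAbelianVariety.Points Ω) := by
      rw [MonoidHom.comp_apply, hbwdT, ← hfwd, hfb]
    have hQ : ((Λ.lift M (Multiplicative.ofAdd y) : (A.fibre s).toAbelianVariety.torsionPoints Ω (M : ℤ)) :
          (A.fibre s).toAbelianVariety.Points Ω) =
        AlgPoints.map e.hom.hom.hom.hom
          (((bwdT M).comp (Λ.lift M) (Multiplicative.ofAdd y) :
              (A'.fibre s').toAbelianVariety.torsionPoints Ω (M : ℤ)) :
            (A'.fibre s').toAbelianVariety.Points Ω) := by
      rw [MonoidHom.comp_apply, hbwdT, ← hfwd, hfb]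
    have key := AbelianVariety.weilPairingLevel_pullback_eq e.hom Θ
      ((bwdT M).comp (Λ.lift M) (Multiplicative.ofAdd x)) ((bwdT M).comp (Λ.lift M) (Multiplicative.ofAdd y))
      (Λ.lift M (Multiplicative.ofAdd x)) (Λ.lift M (Multiplicative.ofAdd y)) hP hQ
    have hΛ := Λ.weilPairingLevel_lift hM hMΩ x y
    convert key.trans hΛ using 1

end AbelianSchemeOver

end Literature.AlgebraicGeometry.AbelianSchemes

/-! ## §3 `IsAdmissibleAt` transports along a fibre isomorphism compatible with sections and polarisations -/

namespace Literature.AlgebraicGeometry.ModuliOfAbelianVarieties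

open Literature.AlgebraicGeometry.Motives (SchemeOver ComplexPoints AlgPoints specOver AbelianVariety CartierDivisor)
open Literature.AlgebraicGeometry.AbelianSchemes (PolarizedAbelianSchemeWithLevel AbelianSchemeOver)
open Literature.NumberTheory.Automorphic (siegelUpperHalfSpace)

/-- **ADMISSIBILITY TRANSPORTS ALONG A FIBRE ISOMORPHISM** (fibre form of «isomorphic triples over `Spec ℂ` have the same
admissibility», [MumfordFogartyKirwan1994] Def. 7.2 «all up to isomorphism»; [Milne2005ShimuraVarieties] Thm. 6.11): let
`P′`, `P″` be polarised abelian schemes of type `δ` with symplectic-liftable level-`N` structure over `Spec ℂ`,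
`e : fibre(P″) ≅ fibre(P′)` an isomorphism of the fibres at `𝟙` carrying the level sections of `P″` to those of `P′`
(`he`), such that every ample `IsLambdaOfAt` witness `Θ` of `P′` pulls back along `e` to an ample `IsLambdaOfAt` witness of
`P″` (`hpol`, the shape of ★ (T2) `IsSymplecticLiftable.of_fibreIso`).  If `P′` is admissible at `(Z, r)` then so is
`P″`: the marking pushes forward along `e⁻¹` (§1), `Θ ↦ e^*Θ`, the symplectic lift transports with tower `e⁻¹ ∘ lift`
(§2), and the tower clause `Λ_M x = m.r v` is applied under `e⁻¹`.
[cite: Milne2005ShimuraVarieties, §6 Thm. 6.11 pp. 74–75] [cite: MumfordFogartyKirwan1994, Ch. 7 §2 Definition 7.2 (p. 129)]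
[cite: Lan2013PELCompactifications, §1.3.6 Lemma 1.3.6.5 (p. 81)] -/
theorem isAdmissibleAt_of_fibreIso {g N : ℕ} {δ : Fin g → ℕ} (hδ : IsPolarizationType δ) {r : gspFinAdelic δ}
    {Z : Matrix (Fin g) (Fin g) ℂ} {hZ : Z ∈ siegelUpperHalfSpace g}
    {P' P'' : PolarizedAbelianSchemeWithLevel g N δ (specOver ℚ ℂ).left}
    (e : (P''.A.fibre (𝟙 (Spec (CommRingCat.of ℂ)))).toAbelianVariety ≅
      (P'.A.fibre (𝟙 (Spec (CommRingCat.of ℂ)))).toAbelianVariety)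
    (he : ∀ i : Fin g ⊕ Fin g,
      AlgPoints.map e.hom.hom.hom.hom (P''.A.restrictPt (𝟙 (Spec (CommRingCat.of ℂ))) (P''.level.σ i)) =
        P'.A.restrictPt (𝟙 (Spec (CommRingCat.of ℂ))) (P'.level.σ i))
    (hpol : ∀ Θ : CartierDivisor (P'.A.fibre (𝟙 (Spec (CommRingCat.of ℂ)))).toAbelianVariety.X.left,
      Θ.IsAmple → P'.A.IsLambdaOfAt (𝟙 (Spec (CommRingCat.of ℂ))) P'.D P'.pol.lam Θ →
        haveI := AbelianVariety.isDominant_toSchemeHom_iso_hom e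
        (Θ.pullback (AbelianVariety.Hom.toSchemeHom e.hom)).IsAmple ∧
          P''.A.IsLambdaOfAt (𝟙 (Spec (CommRingCat.of ℂ))) P''.D P''.pol.lam
            (Θ.pullback (AbelianVariety.Hom.toSchemeHom e.hom)))
    (h : IsAdmissibleAt hδ r Z hZ P') : IsAdmissibleAt hδ r Z hZ P'' := by
  haveI := AbelianVariety.isDominant_toSchemeHom_iso_hom e
  obtain ⟨m, Θ, Λ, hample, hlam, htower⟩ := h
  -- §1: the marking of `fibre(P′)` pushes forward along `e⁻¹` to a marking of `fibre(P″)`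
  obtain ⟨m'', -, hm''⟩ := m.exists_of_iso e.symm
  -- the polarisation witness `e^*Θ`
  obtain ⟨hample'', hlam''⟩ := hpol Θ hample hlam
  -- §2: the symplectic lift transports, with tower `e⁻¹ ∘ lift`
  obtain ⟨Λ'', -, hΛ''⟩ :=
    AbelianSchemeOver.LevelStructure.SymplecticLift.exists_transport_lift_eq (φ := P'.level) (φ' := P''.level) e he Λ
  refine ⟨m'', Θ.pullback (AbelianVariety.Hom.toSchemeHom e.hom), Λ'', hample'', hlam'', ?_⟩
  intro M hNM hM0 x v hv
  rw [hΛ'', htower hNM hM0 x v hv, hm'' v]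
  rfl

end Literature.AlgebraicGeometry.ModuliOfAbelianVarieties

end
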